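import Summits.Ventures.LatticeQCDFlow.Scoring.SU2HaarClassAngle
import Summits.Ventures.LatticeQCDFlow.Scaling.PlaquetteIndependence2D
import HarnessLib

/-!
# SU(2) Wilson theory on the 2-torus `(ℤ/L)²`: the partition function up to one plaquette in Bessel form, and the exact one-plaquette law of the punctured torus

HONEST FRAMING: exact (Metropolis-corrected) sampling algorithms for lattice gauge theory;
figures of merit are autocorrelation/cost numbers at stated couplings and volumes; no
continuum-physics claim.

Venture `LatticeQCDFlow` (cell pub-lqcd), sub-topic `Scoring`; FANOUT row 5 (`s0-sun-a`), GEN-9.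
NEW WORK of the cell (placement rule); companion of `Scoring/SU2HaarClassAngle.lean` (theory-2's
SU(2) one-plaquette integral `z₁(β) = ∫ e^{−β(2 − tr U)} dHaar_SU(2) = e^{−2β}(I₀(2β) − I₂(2β))
= e^{−2β} I₁(2β)/β`, the Haar one-plaquette law `⟨½ tr U⟩ = I₂(2β)/I₁(2β)`), combined with lean-1's
two-dimensional structure theorems (`Scaling/PlaquetteIndependence2D.lean`: off one puncture the
plaquette holonomies of `(ℤ/L)²` are i.i.d. Haar; `e^{−βs} z₁^{L²−1} ≤ Z ≤ z₁^{L²−1}`):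

* `partitionFunction_su2_two_mem`, **`partitionFunction_su2_two_le_besselI`** /
  **`besselI_le_partitionFunction_su2_two`** — for every `L ≥ 2` and `β ≥ 0`,
  `e^{−4β}·(e^{−2β}(I₀(2β) − I₂(2β)))^{L²−1} ≤ Z_{(ℤ/L)²}^{SU(2)}(β) ≤ (e^{−2β}(I₀(2β) − I₂(2β)))^{L²−1}`
  (theory-2's `partitionFunction (fundamentalRep (Fin 2)) β` on `GaugeConfig 2 L SU(2)`): the
  SU(2) free energy of the 2-torus is `(L² − 1)·log(e^{−2β} I₁(2β)/β)` up to ONE plaquette weight;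
* `lintegral_plaquette_mul_prod_weight_erase` — the PUNCTURED torus, ANY compact second-countable
  `G` and continuous `ρ`: with the weight of one plaquette `x₀` switched off, for every other
  plaquette `x ≠ x₀` and measurable `F ≥ 0`,
  `∫ F(U_x)·∏_{y ≠ x₀} e^{−β(N − Re tr ρ(U_y))} dHaar^{⊗E} = (∫ F·e^{−β(N − Re tr ρ)} dHaar)·z₁(β)^{L²−2}`
  — every plaquette off the puncture has EXACTLY the one-plaquette law (lean-1's
  `TwoDim.lintegral_prod_plaquette_eq` with one factor changed);
* **`haar_punctured_su2_mean`** — hence for SU(2): the punctured-torus plaquette is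
  `⟨½ tr U_x⟩ = I₂(2β)/I₁(2β)` (stated through the non-negative observable `1 + a₀`, every real `β`,
  every `L ≥ 2`): the value of the cell's SU(2) reference table at `b = 2β`, now as a statement
  about theory-2's Haar-based lattice measure.

NOT here (still NOT TYPED): the exact (unpunctured) SU(2) torus formula — a character sum needing
Schur orthogonality for all irreducible representations of SU(2); SU(3); non-abelian Wilson loops
larger than one plaquette.
-/

noncomputable section

open Real MeasureTheory intervalIntegral Set
open Literature.MathematicalPhysics.QuantumFieldTheory Literature.MathematicalPhysics.QuantumLattice
open Literature.Analysis.FunctionSpaces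
open Summit.Ventures.LatticeQCDFlow.Exactness
open Summit.Ventures.LatticeQCDFlow.Theory2.Lattice

namespace Summit.Ventures.LatticeQCDFlow.Scoring

/-! ## §1. The 2-torus: SU(2) Wilson theory on `(ℤ/L)²` up to one plaquette, in Bessel form -/

/-- The SU(2) plaquette action is at most `4`: `2 − Re tr U ≤ 4`. -/
theorem su2_plaqAction_le_four (U : (Matrix.specialUnitaryGroup (Fin 2) ℂ)) :
    ((2 : ℕ) : ℝ) - ((fundamentalRep (Fin 2) U).trace).re ≤ 4 := by
  rw [fundamentalRep_trace_re]
  have := abs_le.mp (abs_su2a0_le_one U)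
  push_cast; linarith [this.1]

/-- `Re tr U ≤ 2` on SU(2). -/
theorem su2_trace_re_le_two (U : (Matrix.specialUnitaryGroup (Fin 2) ℂ)) : ((fundamentalRep (Fin 2) U).trace).re ≤ (2 : ℕ) := by
  rw [fundamentalRep_trace_re]
  have := abs_le.mp (abs_su2a0_le_one U)
  push_cast; linarith [this.2]

/-- **lean-1's 2-d sandwich for SU(2)**: for `β ≥ 0` and `L ≥ 2`,
`e^{−4β}·z₁(β)^{L²−1} ≤ Z_{(ℤ/L)²}^{SU(2)}(β) ≤ z₁(β)^{L²−1}`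
(`Scaling/PlaquetteIndependence2D.lean`, with `s = 4`, `Re tr ≤ 2`, `ρ` continuous). -/
theorem partitionFunction_su2_two_mem (L : ℕ) [NeZero L] (hL : 2 ≤ L) {β : ℝ} (hβ : 0 ≤ β) :
    ENNReal.ofReal (Real.exp (-(β * 4))) * z1 (fundamentalRep (Fin 2)) β ^ (L ^ 2 - 1) ≤
        partitionFunction (d := 2) (L := L) (fundamentalRep (Fin 2)) β ∧
      partitionFunction (d := 2) (L := L) (fundamentalRep (Fin 2)) β ≤
        z1 (fundamentalRep (Fin 2)) β ^ (L ^ 2 - 1) :=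
  haveI : SecondCountableTopology (Matrix (Fin 2) (Fin 2) ℂ) :=
    inferInstanceAs (SecondCountableTopology (Fin 2 → Fin 2 → ℂ))
  haveI : SecondCountableTopology (Matrix.specialUnitaryGroup (Fin 2) ℂ) := TopologicalSpace.Subtype.secondCountableTopology _
  ⟨TwoDim.le_partitionFunction_two (fundamentalRep (Fin 2)) hL (continuous_fundamentalRep _)
      su2_plaqAction_le_four hβ,
    TwoDim.partitionFunction_two_le (fundamentalRep (Fin 2)) hL (continuous_fundamentalRep _)
      su2_trace_re_le_two hβ⟩

/-- **Upper Bessel bound on the SU(2) 2-torus partition function**: for `β ≥ 0`, `L ≥ 2`,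
`Z_{(ℤ/L)²}^{SU(2)}(β) ≤ (e^{−2β}(I₀(2β) − I₂(2β)))^{L²−1}`. -/
theorem partitionFunction_su2_two_le_besselI (L : ℕ) [NeZero L] (hL : 2 ≤ L) {β : ℝ} (hβ : 0 ≤ β) :
    partitionFunction (d := 2) (L := L) (fundamentalRep (Fin 2)) β ≤
      ENNReal.ofReal ((Real.exp (-(2 * β)) * (besselI 0 (2 * β) - besselI 2 (2 * β))) ^ (L ^ 2 - 1)) := by
  have h := (partitionFunction_su2_two_mem L hL hβ).2
  rw [z1_su2_eq_besselI, ← ENNReal.ofReal_pow (by rw [← z1_su2_toReal]; exact ENNReal.toReal_nonneg)] at h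
  exact h

/-- **Lower Bessel bound on the SU(2) 2-torus partition function**: for `β ≥ 0`, `L ≥ 2`,
`e^{−4β}·(e^{−2β}(I₀(2β) − I₂(2β)))^{L²−1} ≤ Z_{(ℤ/L)²}^{SU(2)}(β)`. With the upper bound: the SU(2)
free energy of the 2-torus is `(L² − 1)·log(e^{−2β} I₁(2β)/β)` up to ONE plaquette weight. -/
theorem besselI_le_partitionFunction_su2_two (L : ℕ) [NeZero L] (hL : 2 ≤ L) {β : ℝ} (hβ : 0 ≤ β) :
    ENNReal.ofReal (Real.exp (-(β * 4)) *
        (Real.exp (-(2 * β)) * (besselI 0 (2 * β) - besselI 2 (2 * β))) ^ (L ^ 2 - 1)) ≤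
      partitionFunction (d := 2) (L := L) (fundamentalRep (Fin 2)) β := by
  have h := (partitionFunction_su2_two_mem L hL hβ).1
  have h0 : 0 ≤ Real.exp (-(2 * β)) * (besselI 0 (2 * β) - besselI 2 (2 * β)) := by
    rw [← z1_su2_toReal]; exact ENNReal.toReal_nonneg
  rw [z1_su2_eq_besselI, ← ENNReal.ofReal_pow h0, ← ENNReal.ofReal_mul (Real.exp_pos _).le] at h
  exact h

/-! ## §2. The punctured torus: every plaquette off the puncture has EXACTLY the one-plaquette law -/

section Punctured

open scoped ENNReal

variable {N : ℕ} {G : Type*} [Group G] [TopologicalSpace G] [IsTopologicalGroup G] [CompactSpace G]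
  [SecondCountableTopology G] [MeasurableSpace G] [BorelSpace G]
  (ρ : G →* Matrix (Fin N) (Fin N) ℂ)

/-- **Punctured 2-torus, any compact `G`**: switching off the Wilson weight of the plaquette `x₀` of
`(ℤ/L)²` (`L ≥ 2`), for every other plaquette `x ≠ x₀` and every measurable `F : G → [0,∞]`,
`∫ F(U_x)·∏_{y ≠ x₀} e^{−β(N − Re tr ρ(U_y))} dHaar^{⊗E}(U) = (∫ F·e^{−β(N − Re tr ρ)} dHaar)·z₁(β)^{L²−2}`:
the plaquettes off the puncture are i.i.d. with the ONE-PLAQUETTE law `e^{−β(N − Re tr ρ g)} dHaar(g)/z₁`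
(lean-1's `TwoDim.lintegral_prod_plaquette_eq` with one factor changed). -/
theorem lintegral_plaquette_mul_prod_weight_erase {L : ℕ} [NeZero L] (hL : 2 ≤ L) {x₀ x : Site 2 L}
    (hx : x ≠ x₀) (hρ : Continuous (ρ : G → Matrix (Fin N) (Fin N) ℂ)) (β : ℝ)
    (F : G → ℝ≥0∞) (hF : Measurable F) :
    ∫⁻ U, F (plaquetteHolonomy U x 0 1) * ∏ y ∈ Finset.univ.erase x₀,
        ENNReal.ofReal (Real.exp (-(β * ((N : ℝ) - (ρ (plaquetteHolonomy U y 0 1)).trace.re))))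
        ∂(Measure.pi fun _ : Edge 2 L => haarProbability G) =
      (∫⁻ g, F g * ENNReal.ofReal (Real.exp (-(β * ((N : ℝ) - (ρ g).trace.re)))) ∂(haarProbability G)) *
        z1 ρ β ^ (L ^ 2 - 2) := by
  classical
  set w : G → ℝ≥0∞ := fun g => ENNReal.ofReal (Real.exp (-(β * ((N : ℝ) - (ρ g).trace.re)))) with hw
  have hwm : Measurable w := TwoDim.measurable_oneWeight ρ hρ β
  -- the modified family: `F·w` at `x`, `w` elsewhere
  set Fam : Site 2 L → G → ℝ≥0∞ := fun y => if y = x then fun g => F g * w g else w with hFam_def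
  have hFx : Fam x = fun g => F g * w g := by rw [hFam_def]; exact if_pos rfl
  have hFy : ∀ y, y ≠ x → Fam y = w := fun y hy => by rw [hFam_def]; exact if_neg hy
  have hFam : ∀ y, Measurable (Fam y) := fun y => by
    by_cases hy : y = x
    · rw [hy, hFx]; exact hF.mul hwm
    · rw [hFy y hy]; exact hwm
  set T : Finset (Site 2 L) := Finset.univ.erase x₀ with hT_def
  have hxT : x ∈ T := Finset.mem_erase.mpr ⟨hx, Finset.mem_univ _⟩
  have key := TwoDim.lintegral_prod_plaquette_eq hL x₀ Fam hFam T (Finset.notMem_erase x₀ _)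
  -- rewrite both products with the factor at `x` pulled out
  have hl : ∀ U : GaugeConfig 2 L G, ∏ y ∈ T, Fam y (plaquetteHolonomy U y 0 1) =
      F (plaquetteHolonomy U x 0 1) * ∏ y ∈ T, w (plaquetteHolonomy U y 0 1) := by
    intro U
    have e1 : ∏ y ∈ T, Fam y (plaquetteHolonomy U y 0 1) =
        Fam x (plaquetteHolonomy U x 0 1) * ∏ y ∈ T.erase x, Fam y (plaquetteHolonomy U y 0 1) :=
      (Finset.mul_prod_erase T (fun y => Fam y (plaquetteHolonomy U y 0 1)) hxT).symm
    have e2 : ∏ y ∈ T, w (plaquetteHolonomy U y 0 1) =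
        w (plaquetteHolonomy U x 0 1) * ∏ y ∈ T.erase x, w (plaquetteHolonomy U y 0 1) :=
      (Finset.mul_prod_erase T (fun y => w (plaquetteHolonomy U y 0 1)) hxT).symm
    have e3 : ∏ y ∈ T.erase x, Fam y (plaquetteHolonomy U y 0 1) =
        ∏ y ∈ T.erase x, w (plaquetteHolonomy U y 0 1) :=
      Finset.prod_congr rfl fun y hy => by rw [hFy y (Finset.ne_of_mem_erase hy)]
    have e4 : Fam x (plaquetteHolonomy U x 0 1) =
        F (plaquetteHolonomy U x 0 1) * w (plaquetteHolonomy U x 0 1) := by rw [hFx]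
    rw [e1, e2, e3, e4, mul_assoc]
  have hcard : (T.erase x).card = L ^ 2 - 2 := by
    rw [Finset.card_erase_of_mem hxT, hT_def, Finset.card_erase_of_mem (Finset.mem_univ _),
      Finset.card_univ, Fintype.card_fun, ZMod.card, Fintype.card_fin]
    omega
  have hr : ∏ y ∈ T, ∫⁻ g, Fam y g ∂(haarProbability G) =
      (∫⁻ g, F g * w g ∂(haarProbability G)) * z1 ρ β ^ (L ^ 2 - 2) := by
    have e1 : ∏ y ∈ T, ∫⁻ g, Fam y g ∂(haarProbability G) =
        (∫⁻ g, Fam x g ∂(haarProbability G)) * ∏ y ∈ T.erase x, ∫⁻ g, Fam y g ∂(haarProbability G) :=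
      (Finset.mul_prod_erase T (fun y => ∫⁻ g, Fam y g ∂(haarProbability G)) hxT).symm
    have e2 : ∫⁻ g, Fam x g ∂(haarProbability G) = ∫⁻ g, F g * w g ∂(haarProbability G) := by
      rw [hFx]
    have hz : ∀ y ∈ T.erase x, ∫⁻ g, Fam y g ∂(haarProbability G) = z1 ρ β := fun y hy => by
      rw [hFy y (Finset.ne_of_mem_erase hy), hw]; rfl
    rw [e1, e2, Finset.prod_congr rfl hz, Finset.prod_const, hcard]
  simp_rw [hl] at key
  rw [key, hr]

end Punctured

/-- **The punctured SU(2) 2-torus plaquette is `I₂(2β)/I₁(2β)`**: with one plaquette weight switched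
off, for every other plaquette `x`, `∫ (1 + a₀(U_x))·∏_{y≠x₀} w(U_y) / ∫ ∏_{y≠x₀} w(U_y)
= 1 + I₂(2β)/I₁(2β)` (`L ≥ 2`, every real `β`; stated with the non-negative observable `1 + a₀`,
`|a₀| ≤ 1`, so that everything is a lower Lebesgue integral). -/
theorem haar_punctured_su2_mean {L : ℕ} [NeZero L] (hL : 2 ≤ L) {x₀ x : Site 2 L} (hx : x ≠ x₀)
    (β : ℝ) :
    (∫⁻ U, ENNReal.ofReal (1 + su2a0 (plaquetteHolonomy U x 0 1)) * ∏ y ∈ Finset.univ.erase x₀,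
        ENNReal.ofReal (Real.exp (-(β * (((2 : ℕ) : ℝ) -
          ((fundamentalRep (Fin 2) (plaquetteHolonomy U y 0 1)).trace).re))))
        ∂(Measure.pi fun _ : Edge 2 L => haarProbability (Matrix.specialUnitaryGroup (Fin 2) ℂ))).toReal /
      (∫⁻ U, ∏ y ∈ Finset.univ.erase x₀,
        ENNReal.ofReal (Real.exp (-(β * (((2 : ℕ) : ℝ) -
          ((fundamentalRep (Fin 2) (plaquetteHolonomy U y 0 1)).trace).re))))
        ∂(Measure.pi fun _ : Edge 2 L => haarProbability (Matrix.specialUnitaryGroup (Fin 2) ℂ))).toReal =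
      1 + besselI 2 (2 * β) / besselI 1 (2 * β) := by
  haveI : SecondCountableTopology (Matrix (Fin 2) (Fin 2) ℂ) :=
    inferInstanceAs (SecondCountableTopology (Fin 2 → Fin 2 → ℂ))
  haveI : SecondCountableTopology (Matrix.specialUnitaryGroup (Fin 2) ℂ) := TopologicalSpace.Subtype.secondCountableTopology _
  have hm : Measurable fun g : (Matrix.specialUnitaryGroup (Fin 2) ℂ) => ENNReal.ofReal (1 + su2a0 g) :=
    (continuous_const.add continuous_su2a0).measurable.ennreal_ofReal
  rw [lintegral_plaquette_mul_prod_weight_erase (fundamentalRep (Fin 2)) hL hx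
      (continuous_fundamentalRep _) β _ hm,
    TwoDim.lintegral_prod_weight_erase (fundamentalRep (Fin 2)) hL x₀ (continuous_fundamentalRep _) β]
  -- the one-plaquette numerator as a Bochner integral
  have hc1 : Continuous fun U : (Matrix.specialUnitaryGroup (Fin 2) ℂ) => (1 + su2a0 U) * Real.exp (-(β * (2 - 2 * su2a0 U))) := by
    have := continuous_su2a0; fun_prop
  have hnn : ∀ U : (Matrix.specialUnitaryGroup (Fin 2) ℂ), 0 ≤ (1 + su2a0 U) * Real.exp (-(β * (2 - 2 * su2a0 U))) := fun U => by
    have := abs_le.mp (abs_su2a0_le_one U)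
    exact mul_nonneg (by linarith [this.1]) (Real.exp_pos _).le
  have hnum : ∫⁻ g : (Matrix.specialUnitaryGroup (Fin 2) ℂ), ENNReal.ofReal (1 + su2a0 g) *
      ENNReal.ofReal (Real.exp (-(β * (((2 : ℕ) : ℝ) - ((fundamentalRep (Fin 2) g).trace).re))))
        ∂(haarProbability (Matrix.specialUnitaryGroup (Fin 2) ℂ)) =
      ENNReal.ofReal (∫ U, (1 + su2a0 U) * Real.exp (-(β * (2 - 2 * su2a0 U))) ∂(haarProbability (Matrix.specialUnitaryGroup (Fin 2) ℂ))) := by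
    rw [ofReal_integral_eq_lintegral_ofReal (integrable_of_continuous_SU2 hc1)
      (Filter.Eventually.of_forall hnn)]
    refine lintegral_congr fun U => ?_
    rw [su2_plaqWeight_eq, ← ENNReal.ofReal_mul (by
      have := abs_le.mp (abs_su2a0_le_one U); linarith [this.1])]
  rw [hnum]
  -- powers of z₁: L² − 1 = (L² − 2) + 1
  have hL2 : L ^ 2 - 1 = (L ^ 2 - 2) + 1 := by
    have : 4 ≤ L ^ 2 := by nlinarith
    omega
  rw [hL2, pow_succ (z1 (fundamentalRep (Fin 2)) β) (L ^ 2 - 2), ENNReal.toReal_mul,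
    ENNReal.toReal_mul, ENNReal.toReal_pow, ENNReal.toReal_ofReal (integral_nonneg hnn)]
  have hz : 0 < (z1 (fundamentalRep (Fin 2)) β).toReal := z1_su2_toReal_pos β
  have hzp : 0 < (z1 (fundamentalRep (Fin 2)) β).toReal ^ (L ^ 2 - 2) := pow_pos hz _
  rw [mul_comm ((z1 (fundamentalRep (Fin 2)) β).toReal ^ (L ^ 2 - 2)) (z1 (fundamentalRep (Fin 2)) β).toReal,
    mul_div_mul_right _ _ hzp.ne']
  -- now a ratio of Haar integrals = class-angle expectation of `1 + cos α`
  have hden : (z1 (fundamentalRep (Fin 2)) β).toReal =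
      ∫ U, Real.exp (-(β * (2 - 2 * su2a0 U))) ∂(haarProbability (Matrix.specialUnitaryGroup (Fin 2) ℂ)) := by
    unfold z1
    simp_rw [su2_plaqWeight_eq]
    have hc : Continuous fun U : (Matrix.specialUnitaryGroup (Fin 2) ℂ) => Real.exp (-(β * (2 - 2 * su2a0 U))) := by
      have := continuous_su2a0; fun_prop
    rw [← ofReal_integral_eq_lintegral_ofReal (integrable_of_continuous_SU2 hc)
      (Filter.Eventually.of_forall fun U => (Real.exp_pos _).le),
      ENNReal.toReal_ofReal (integral_nonneg fun U => (Real.exp_pos _).le)]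
  rw [hden, haar_su2_expect_eq_onePlaquetteExpectSU2 β (fun t => 1 + t) (by fun_prop)]
  -- `⟨1 + cos α⟩ = 1 + ⟨cos α⟩`
  have hsplit : onePlaquetteExpectSU2 (2 * β) (fun α => 1 + Real.cos α) =
      1 + onePlaquetteExpectSU2 (2 * β) Real.cos := by
    unfold onePlaquetteExpectSU2
    have hZ := onePlaquetteZSU2_pos (2 * β)
    have hi1 : IntervalIntegrable (fun α => Real.sin α ^ 2 * Real.exp (2 * β * Real.cos α)) volume 0 π :=
      (by fun_prop : Continuous fun α => Real.sin α ^ 2 * Real.exp (2 * β * Real.cos α)).intervalIntegrable _ _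
    have hi2 : IntervalIntegrable (fun α => Real.cos α * (Real.sin α ^ 2 * Real.exp (2 * β * Real.cos α)))
        volume 0 π :=
      (by fun_prop : Continuous fun α =>
        Real.cos α * (Real.sin α ^ 2 * Real.exp (2 * β * Real.cos α))).intervalIntegrable _ _
    have h : (fun α => (1 + Real.cos α) * (Real.sin α ^ 2 * Real.exp (2 * β * Real.cos α))) =
        fun α => Real.sin α ^ 2 * Real.exp (2 * β * Real.cos α) +
          Real.cos α * (Real.sin α ^ 2 * Real.exp (2 * β * Real.cos α)) := by
      funext α; ring
    rw [h, intervalIntegral.integral_add hi1 hi2, add_div]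
    congr 1
    exact div_self hZ.ne'
  rw [hsplit, onePlaquetteExpectSU2_cos_eq_besselI_div]

end Summit.Ventures.LatticeQCDFlow.Scoring
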